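import Summits.QuantumFields.BalabanUV.Beta.GAN24.StaircaseFaceDensity
import Summits.QuantumFields.BalabanUV.Beta.GAN24.ContactFaceJumpCommutator
import Summits.QuantumFields.BalabanUV.Beta.GAN24.ContactOneGaugeCellBound

/-!
# `GAN24.ContactLambdaCellBound` — CT-ROUTE, the row owner's `gen20/BORNSEC-PLAN-v1.md` v1.1 §0 (c) ∕ §A (Λ-C) **(C4) PART 1: THE ABSTRACT CELL BOUND WITH THE
# BLOCK-SCALE ENVELOPES KEPT** — leaf-03 g54's count `StaircaseFaceDensity.tsum_abs_mul_le_of_faceLetter` (§5) with a `y`-DEPENDENT leg ∕ envelope letter, the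
# commutator letters of leaf-01 g60's `ContactFaceJumpCommutator` §3 (mixed) and §4 (ΔΔ) in envelope form, and the (μ,y)-sum of a factorised Λ cell
# `Σ_μ Σ'_y ⟨W, c(μ,y;·)⟩·[𝒬^ρ_{Lc}, ψ̄]R (μ,y)` (leaf-02 g48's `ContactLambdaCellFactorised`) against three block-scale envelopes — tent (`u′`), leg (`x₀`),
# gauge source (`z₀`) — with the LOCALISED output `e^{−(κ∕12)(‖x₀−u′‖∞ + ‖z₀−u′‖∞)}` that the `LocStencil` currency of `BornLambdaLettersPoly.exists_hBLam_of_polyGeometric_three`'s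
# binder `hCg` needs (OWNER gan24-p1-g21 [GAN24P1-G21-ONLINE] (W1) «(C4) IS YOURS»; journal `CLAIMS.log` l.34168 ∕ l.34465)

HONEST FRAMING (cell charter, verbatim): «discharging `BetaPertH` makes Bałaban's UV stability UNCONDITIONAL — a real constructive-QFT result;
it is NOT the continuum limit and NOT the Clay problem.»  DERIVED cell leaf (pub-balaban, G-an2-4 formalisation swarm → CRUX TEAM (2), seat
`b2b-balaban-gan24-formalise-leaf-02`, gen 49): [folklore] bookkeeping (domination of sums, three exponential envelopes) over leaf-03's `StaircaseFaceDensity` §5 (`tsum_abs_mul_le_of_faceLetter'`, v2.1),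
leaf-01's `ContactFaceJumpCommutator` §3–§4 and this lineage's `ContactOneGaugeCellBound.tsum_env3_le` BY NAME; NO cited fact, NO `def`, NO `def … : Prop`, NO sorry,
NO wall binder; every analytic input a LETTER (hypothesis).  Discharges NO letter of (CONV-C) by itself: the letters are (C2) = gan24-p2's `BornLambdaBracketLetter`,
(C3) = leaf-01's `ContactFaceJump*` + PART 2 `ContactGaugeStaircaseLocal`, the entry bound is PART 3 `ContactLambdaEntryBound`, the `d = 3` lineage count and the letter `hCg` are PARTS 4–5 `BornLambdaContactLineage` ∕ `BornLambdaContactBound`; NEVER «G-an2-4 closed»; NOT hS0, NOT D1,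
NOT `BetaPertH`, NOT continuum, NOT Clay.  «not in print; our bookkeeping».
HONEST DEPENDENCY (cell records, verbatim): «continuum YM on T⁴ ⇐ BetaPertH ∧ nine spine estimates (0/9 proved); BetaPertH ⇐ (D1) ∧ (D4) ∧ CAP+tail;
G-an2-4 gates asym, D1 and NE2/3/4.»
ABSOLUTE RULE (cell charter, verbatim): «No internally-minted statement may enter as a cited fact. Every hypothesis is either kernel-proved in this
package or a verbatim quotation of a PUBLISHED theorem with page reference. The manuscript(s) under audit are NOT citable for their own disputed steps —
they are the thing under adjudication; programme-internal (2001/route/tribunal) claims are never citable.»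

## What is proved (generic `d`; box root `ρ = toSite rr`; the commutator INLINE as in `ContactFaceJumpCommutator`)
* §1 the per-direction count is leaf-03 g54's `StaircaseFaceDensity.tsum_abs_mul_le_of_faceLetter'` (v2.1 p297221, the site-dependent leg ∕ envelope letter `K y` this
  seat asked for — BY NAME, not restated); here only the finite outer sum `abs_sum_tsum_le`.
* §2 envelope algebra: `l1_le_mul_supNorm`, `exp_supNorm_le_exp_l1` (sup → ℓ¹ on labels at rate `κ∕(d+1)`), `exp_env_mono_rate` (a slower rate dominates).
* §3 THE COMMUTATOR LETTERS IN ENVELOPE FORM: **`abs_commutator_le_of_staircase_of_env`** (mixed: finest-piece weight `≤ W₀·E`, jumps `≤ F·E`, leg `≤ M` on `nearBox`,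
  count `≤ Cnt` ⇒ `|[𝒬^ρ_{Lc}, ψ̄]B (μ,y)| ≤ (W₀ + F)·(E·M·Cnt)`) and **`abs_commutator_dz_le_of_staircase_of_env`** (ΔΔ: `≤ (W_a·g_b + (W_a + g_b)·F)·(E_a·E_b·Cnt)` for a
  common jump letter `F`) — leaf-01's PART 3 §3 ∕ §4 with the envelopes factored out.
* §4 **`abs_sum_tsum_mul_le_of_env3`** — THE CELL COUNT: brackets `|b μ y| ≤ T·e^{−κ‖quo M y − u′‖∞}`, commutators `|c μ y| ≤ (W₀ + F_μ y)·(K₀·e^{−κ‖quo M y − x₀‖∞}·e^{−κ‖quo M y − z₀‖∞})`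
  with the face letter `F_μ y = Σ_{s<n} [Lc^s ∣ y_μ+1]·2·a (s+1)`, `0 ≤ a (s+1) ≤ α·Lc^{s+1}`, `Lc^s ∣ M` (`s < n`), `1 ≤ M`, `0 < κ` ⇒ every `y`-family is summable and
  `|Σ_μ Σ'_y b μ y·c μ y| ≤ (d+1)·T·K₀·(W₀ + 2·α·Lc·n)·(M^{d+1}·Zl(κ∕(4(d+1))))·e^{−(κ∕12)(‖x₀−u′‖∞ + ‖z₀−u′‖∞)}` — ONE factor `n`, the free block sum `M^{d+1}`, and the two outer
  labels localised at the observation label `u′`.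
NOT HERE: the letters themselves ((C2) tent: `BornLambdaBracketLetter`; (C3): `ContactFaceJump*` + PART 2), the entry bound (PART 3), the lineage instance and the unit count (PARTS 4–5).
Provenance: seat b2b-balaban-gan24-formalise-leaf-02 gen 49 (prover-…-leaf-02-g49-0), 2026-08-21; over the files named above BY NAME.
-/

noncomputable section

open Finset
open scoped BigOperators
open Literature.MathematicalPhysics.QuantumFieldTheory
open Literature.MathematicalPhysics.QuantumFieldTheory.LatticeForm (quo)
open Literature.MathematicalPhysics.QuantumFieldTheory.Balaban1983to89
open Literature.MathematicalPhysics.QuantumFieldTheory.Balaban1983to89.Beta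
open B4ContourShift (supNorm supNorm_nonneg abs_le_supNorm)
open B12Sec2to5 (l1 l1_nonneg)
open ExpKernelCalculus (Zl Zl_nonneg)
open AffineAveraging (Form0 Form1 Site box toSite unitVec dz)
open AveragingContours (blk)
open AveragingContoursRooted (linAvgAt)
open AveragingHessianKernelsRooted (linCountAt)
open Summit.QuantumFields.BalabanUV.Beta.LinearGaugeVH (nearBox mem_nearBox)
open Summit.QuantumFields.BalabanUV.Beta.GAN24.StaircaseFaceDensity (tsum_abs_mul_le_of_faceLetter')
open Summit.QuantumFields.BalabanUV.Beta.GAN24.ContactFaceJumpCommutator (abs_commutator_le_of_staircase_of_le abs_commutator_dz_le_of_staircase_of_le)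
open Summit.QuantumFields.BalabanUV.Beta.GAN24.ContactOneGaugeCellBound (tsum_env3_le)

namespace Summit.QuantumFields.BalabanUV.Beta.GAN24.ContactLambdaCellBound

variable {d : ℕ}

/-! ## §1 The finite outer sum (leaf-03's `tsum_abs_mul_le_of_faceLetter'` is the per-direction count) -/

/-- [folklore] The finite outer sum: `|Σ_μ Σ'_y b μ y·c μ y| ≤ Σ_μ Σ'_y |b μ y·c μ y|` once every `y`-family is summable. -/
theorem abs_sum_tsum_le {b c : Fin (d + 1) → Site (d + 1) → ℝ} (hS : ∀ μ, Summable fun y : Site (d + 1) => b μ y * c μ y) :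
    |∑ μ, ∑' y : Site (d + 1), b μ y * c μ y| ≤ ∑ μ, ∑' y : Site (d + 1), |b μ y * c μ y| := by
  refine (Finset.abs_sum_le_sum_abs _ _).trans (Finset.sum_le_sum fun μ _ => ?_)
  have h := norm_tsum_le_tsum_norm (hS μ).norm
  simpa only [Real.norm_eq_abs] using h

/-! ## §2 Envelope algebra: sup → ℓ¹ on labels, slower rates dominate -/

/-- [folklore] `|v|₁ ≤ (d+1)·‖v‖∞`. -/
theorem l1_le_mul_supNorm (v : Site (d + 1)) : l1 v ≤ ((d : ℝ) + 1) * supNorm v := by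
  unfold l1
  calc ∑ μ, |((v μ : ℤ) : ℝ)| ≤ ∑ _μ : Fin (d + 1), supNorm v := Finset.sum_le_sum fun i _ => by
          have h := abs_le_supNorm v i
          rwa [Int.cast_abs] at h
    _ = ((d : ℝ) + 1) * supNorm v := by
          rw [Finset.sum_const, Finset.card_univ, Fintype.card_fin, nsmul_eq_mul]; push_cast; ring

/-- [folklore] **SUP → ℓ¹**: `e^{−κ‖v‖∞} ≤ e^{−(κ∕(d+1))·|v|₁}` (`κ ≥ 0`) — the currency of `ExpKernelCalculus.BiLoc` ∕ `LocStencil`. -/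
theorem exp_supNorm_le_exp_l1 {κ : ℝ} (hκ : 0 ≤ κ) (v : Site (d + 1)) :
    Real.exp (-(κ * supNorm v)) ≤ Real.exp (-(κ / ((d : ℝ) + 1)) * l1 v) := by
  rw [Real.exp_le_exp]
  have hD : (0 : ℝ) < (d : ℝ) + 1 := by positivity
  have h := l1_le_mul_supNorm v
  have e : κ / ((d : ℝ) + 1) * (((d : ℝ) + 1) * supNorm v) = κ * supNorm v := by field_simp
  have hk : 0 ≤ κ / ((d : ℝ) + 1) := div_nonneg hκ hD.le
  nlinarith [mul_le_mul_of_nonneg_left h hk]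

/-- [folklore] **A SLOWER RATE DOMINATES**: `0 ≤ m ≤ a`, `0 ≤ s` ⇒ `e^{−a·s} ≤ e^{−m·s}`. -/
theorem exp_env_mono_rate {a m s : ℝ} (hm : m ≤ a) (hs : 0 ≤ s) : Real.exp (-(a * s)) ≤ Real.exp (-(m * s)) := by
  rw [Real.exp_le_exp]; nlinarith

/-- [folklore] The two-label output in `ℓ¹` currency: `e^{−c(‖x‖∞ + ‖z‖∞)} ≤ e^{−(c∕(d+1))(|x|₁ + |z|₁)}` (`c ≥ 0`). -/
theorem exp_supNorm_add_le_exp_l1 {c : ℝ} (hc : 0 ≤ c) (x z : Site (d + 1)) :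
    Real.exp (-c * (supNorm x + supNorm z)) ≤ Real.exp (-(c / ((d : ℝ) + 1)) * (l1 x + l1 z)) := by
  rw [Real.exp_le_exp]
  have hD : (0 : ℝ) < (d : ℝ) + 1 := by positivity
  have hx := l1_le_mul_supNorm x
  have hz := l1_le_mul_supNorm z
  have e : c / ((d : ℝ) + 1) * (((d : ℝ) + 1) * supNorm x + ((d : ℝ) + 1) * supNorm z) = c * (supNorm x + supNorm z) := by
    field_simp
  have hk : 0 ≤ c / ((d : ℝ) + 1) := div_nonneg hc hD.le
  nlinarith [mul_le_mul_of_nonneg_left (add_le_add hx hz) hk]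

/-! ## §3 The commutator letters in envelope form -/

section Commutator

variable {Lc : ℕ} {rr : Fin (d + 1) → ℕ}

/-- NOT IN PRINT; OUR BOOKKEEPING ([folklore] over leaf-01's PART 3 §3).  **THE MIXED COMMUTATOR LETTER, ENVELOPE FORM**: for a staircase `ψ = Σ_{s<n+1} G s ∘ blk (Lc^s)`
whose finest-piece four-site weight is `≤ W₀·E` on the support box and whose face jumps across the bond `(μ,y)` sum to `≤ F·E` (ONE envelope value `E ≥ 0` for the bond),
a leg `|B α x| ≤ M` on the support box and a count `Σ_x Σ_α |linCountAt| ≤ Cnt`: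
`|[𝒬^ρ_{Lc}, ψ̄]B (μ,y)| ≤ (W₀ + F)·(E·M·Cnt)`. -/
theorem abs_commutator_le_of_staircase_of_env (hLc : 1 ≤ Lc) (hrr : rr ∈ box (d + 1) Lc) (G : ℕ → Site (d + 1) → ℝ) (n : ℕ)
    {ψ : Site (d + 1) → ℝ} (hψ : ∀ u, ψ u = ∑ s ∈ Finset.range (n + 1), G s (blk (Lc ^ s) u)) (B : Form1 (d + 1) ℝ) (μ : Fin (d + 1)) (y : Site (d + 1))
    {W₀ F E M Cnt : ℝ} (hW₀ : 0 ≤ W₀) (hE : 0 ≤ E) (hM : 0 ≤ M)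
    (hW : ∀ α, ∀ x ∈ nearBox Lc y, |G 0 x + G 0 (x + unitVec α) - G 0 ((Lc : ℤ) • y + toSite rr) - G 0 ((Lc : ℤ) • y + toSite rr + (Lc : ℤ) • unitVec μ)| ≤ W₀ * E)
    (hJ : ∑ s ∈ Finset.range n, |G (s + 1) (blk (Lc ^ s) (y + unitVec μ)) - G (s + 1) (blk (Lc ^ s) y)| ≤ F * E)
    (hB : ∀ α, ∀ x ∈ nearBox Lc y, |B α x| ≤ M)
    (hCnt : ∑ x ∈ nearBox Lc y, ∑ α, |(linCountAt (toSite rr) Lc μ y (α, x) : ℝ)| ≤ Cnt) :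
    |linAvgAt (toSite rr) (fun α x => (ψ x + ψ (x + unitVec α)) * B α x) Lc μ y
        - (ψ ((Lc : ℤ) • y + toSite rr) + ψ ((Lc : ℤ) • y + toSite rr + (Lc : ℤ) • unitVec μ)) * linAvgAt (toSite rr) B Lc μ y|
      ≤ (W₀ + F) * (E * M * Cnt) := by
  have h := abs_commutator_le_of_staircase_of_le hLc hrr G n hψ B μ y hW hB
  have hJ0 : 0 ≤ ∑ s ∈ Finset.range n, |G (s + 1) (blk (Lc ^ s) (y + unitVec μ)) - G (s + 1) (blk (Lc ^ s) y)| :=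
    Finset.sum_nonneg fun _ _ => abs_nonneg _
  have hc0 : 0 ≤ ∑ x ∈ nearBox Lc y, ∑ α, |(linCountAt (toSite rr) Lc μ y (α, x) : ℝ)| :=
    Finset.sum_nonneg fun _ _ => Finset.sum_nonneg fun _ _ => abs_nonneg _
  have hWE : 0 ≤ W₀ * E := mul_nonneg hW₀ hE
  refine h.trans ?_
  calc (W₀ * E + ∑ s ∈ Finset.range n, |G (s + 1) (blk (Lc ^ s) (y + unitVec μ)) - G (s + 1) (blk (Lc ^ s) y)|) * M
          * ∑ x ∈ nearBox Lc y, ∑ α, |(linCountAt (toSite rr) Lc μ y (α, x) : ℝ)|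
        ≤ (W₀ * E + F * E) * M * Cnt := by
          have h1 : (W₀ * E + ∑ s ∈ Finset.range n, |G (s + 1) (blk (Lc ^ s) (y + unitVec μ)) - G (s + 1) (blk (Lc ^ s) y)|) * M
              ≤ (W₀ * E + F * E) * M := mul_le_mul_of_nonneg_right (by linarith) hM
          exact mul_le_mul h1 hCnt hc0 (mul_nonneg (by linarith) hM)
    _ = (W₀ + F) * (E * M * Cnt) := by ring

/-- NOT IN PRINT; OUR BOOKKEEPING ([folklore] over leaf-01's PART 3 §4).  **THE ΔΔ COMMUTATOR LETTER, ENVELOPE FORM** (two staircases `ψ_a`, `ψ_b` of the same depth with a COMMON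
jump letter `F` — the route's two bond gauge functions of one lineage): finest-piece weight of `ψ_a` `≤ W_a·E_a`, finest-piece gradient of `ψ_b` `≤ g_b·E_b` on the support box, jump sums
`J_a ≤ F·E_a`, `J_b ≤ F·E_b` (`E_a, E_b ≥ 0`), count `≤ Cnt`:
`|[𝒬^ρ_{Lc}, ψ̄_a](dz ψ_b)(μ,y)| ≤ (W_a·g_b + (W_a + g_b)·F)·(E_a·E_b·Cnt)` — the two coarse jump sums never multiply (the owner's §0′). -/
theorem abs_commutator_dz_le_of_staircase_of_env (hLc : 1 ≤ Lc) (hrr : rr ∈ box (d + 1) Lc) (Ga Gb : ℕ → Site (d + 1) → ℝ) (n : ℕ)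
    {ψa ψb : Site (d + 1) → ℝ} (hψa : ∀ u, ψa u = ∑ s ∈ Finset.range (n + 1), Ga s (blk (Lc ^ s) u))
    (hψb : ∀ u, ψb u = ∑ s ∈ Finset.range (n + 1), Gb s (blk (Lc ^ s) u)) (μ : Fin (d + 1)) (y : Site (d + 1))
    {Wa gb F Ea Eb Cnt : ℝ} (hWa0 : 0 ≤ Wa) (hgb0 : 0 ≤ gb) (hEa : 0 ≤ Ea) (hEb : 0 ≤ Eb)
    (hWa : ∀ α, ∀ x ∈ nearBox Lc y, |Ga 0 x + Ga 0 (x + unitVec α) - Ga 0 ((Lc : ℤ) • y + toSite rr) - Ga 0 ((Lc : ℤ) • y + toSite rr + (Lc : ℤ) • unitVec μ)| ≤ Wa * Ea)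
    (hgb : ∀ α, ∀ x ∈ nearBox Lc y, |dz (Gb 0) α x| ≤ gb * Eb)
    (hJa : ∑ s ∈ Finset.range n, |Ga (s + 1) (blk (Lc ^ s) (y + unitVec μ)) - Ga (s + 1) (blk (Lc ^ s) y)| ≤ F * Ea)
    (hJb : ∑ s ∈ Finset.range n, |Gb (s + 1) (blk (Lc ^ s) (y + unitVec μ)) - Gb (s + 1) (blk (Lc ^ s) y)| ≤ F * Eb)
    (hCnt : ∑ x ∈ nearBox Lc y, ∑ α, |(linCountAt (toSite rr) Lc μ y (α, x) : ℝ)| ≤ Cnt) :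
    |linAvgAt (toSite rr) (fun α x => (ψa x + ψa (x + unitVec α)) * dz ψb α x) Lc μ y
        - (ψa ((Lc : ℤ) • y + toSite rr) + ψa ((Lc : ℤ) • y + toSite rr + (Lc : ℤ) • unitVec μ)) * linAvgAt (toSite rr) (dz ψb) Lc μ y|
      ≤ (Wa * gb + (Wa + gb) * F) * (Ea * Eb * Cnt) := by
  have h := abs_commutator_dz_le_of_staircase_of_le hLc hrr Ga Gb n n hψa hψb μ y (mul_nonneg hWa0 hEa) hWa hgb
  set Ja : ℝ := ∑ s ∈ Finset.range n, |Ga (s + 1) (blk (Lc ^ s) (y + unitVec μ)) - Ga (s + 1) (blk (Lc ^ s) y)| with hJadef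
  set Jb : ℝ := ∑ s ∈ Finset.range n, |Gb (s + 1) (blk (Lc ^ s) (y + unitVec μ)) - Gb (s + 1) (blk (Lc ^ s) y)| with hJbdef
  have hJa0 : 0 ≤ Ja := Finset.sum_nonneg fun _ _ => abs_nonneg _
  have hJb0 : 0 ≤ Jb := Finset.sum_nonneg fun _ _ => abs_nonneg _
  have hc0 : 0 ≤ ∑ x ∈ nearBox Lc y, ∑ α, |(linCountAt (toSite rr) Lc μ y (α, x) : ℝ)| :=
    Finset.sum_nonneg fun _ _ => Finset.sum_nonneg fun _ _ => abs_nonneg _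
  refine h.trans ?_
  have hpre : Wa * Ea * (gb * Eb + Jb) + Ja * (gb * Eb) ≤ (Wa * gb + (Wa + gb) * F) * (Ea * Eb) := by
    have h1 : Wa * Ea * Jb ≤ Wa * Ea * (F * Eb) := mul_le_mul_of_nonneg_left hJb (mul_nonneg hWa0 hEa)
    have h2 : Ja * (gb * Eb) ≤ (F * Ea) * (gb * Eb) := mul_le_mul_of_nonneg_right hJa (mul_nonneg hgb0 hEb)
    nlinarith
  have hpre0 : 0 ≤ Wa * Ea * (gb * Eb + Jb) + Ja * (gb * Eb) := by positivity
  calc (Wa * Ea * (gb * Eb + Jb) + Ja * (gb * Eb)) * ∑ x ∈ nearBox Lc y, ∑ α, |(linCountAt (toSite rr) Lc μ y (α, x) : ℝ)|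
      ≤ ((Wa * gb + (Wa + gb) * F) * (Ea * Eb)) * Cnt := mul_le_mul hpre hCnt hc0 (hpre0.trans hpre)
    _ = (Wa * gb + (Wa + gb) * F) * (Ea * Eb * Cnt) := by ring

end Commutator

/-! ## §4 The cell count against three block-scale envelopes -/

/-- NOT IN PRINT; OUR BOOKKEEPING ([folklore]; the (C4) count of BORNSEC-PLAN v1.1 §0 (c) with every analytic input a letter and the localisation KEPT).
**THE (μ,y)-SUM OF A FACTORISED Λ CELL AGAINST THREE BLOCK-SCALE ENVELOPES.**  Blocking `M ≥ 1` (the relative blocking `Lc^{k−1−i}` of the lineage), ONE rate `κ > 0`,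
bracket factors `|b μ y| ≤ T·e^{−κ‖quo M y − u′‖∞}` (the tent letter, (C2)), commutator factors
`|c μ y| ≤ (W₀ + Σ_{s<n} [Lc^s ∣ y_μ+1]·2·a (s+1))·(K₀·e^{−κ‖quo M y − x₀‖∞}·e^{−κ‖quo M y − z₀‖∞})` (§3 with the leg envelope centred at the outer label `x₀` and the gauge
source `z₀`), geometric letters `0 ≤ a (s+1) ≤ α·Lc^{s+1}` on dividing scales `Lc^s ∣ M` (`s < n`), `T, K₀, W₀ ≥ 0`.  THEN every `y`-family is summable and
`|Σ_μ Σ'_y b μ y·c μ y| ≤ (d+1)·T·K₀·(W₀ + 2·α·Lc·n)·(M^{d+1}·Zl(κ∕(4(d+1))))·e^{−(κ∕12)(‖x₀ − u′‖∞ + ‖z₀ − u′‖∞)}` — §1 per direction with `K y` = the two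
outer envelopes, then this lineage's three-envelope free block sum `ContactOneGaugeCellBound.tsum_env3_le`. -/
theorem abs_sum_tsum_mul_le_of_env3 {Lc M n : ℕ} (hLc : 1 ≤ Lc) (hM1 : 1 ≤ M) (hM : ∀ s, s < n → Lc ^ s ∣ M) {κ : ℝ} (hκ : 0 < κ)
    {a : ℕ → ℝ} {α : ℝ} (ha : ∀ s, s < n → 0 ≤ a (s + 1) ∧ a (s + 1) ≤ α * (Lc : ℝ) ^ (s + 1))
    {b c : Fin (d + 1) → Site (d + 1) → ℝ} {T K₀ W₀ : ℝ} (hT : 0 ≤ T) (hK₀ : 0 ≤ K₀) (hW₀ : 0 ≤ W₀) (u' x₀ z₀ : Site (d + 1))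
    (hb : ∀ μ y, |b μ y| ≤ T * Real.exp (-(κ * supNorm (quo M y - u'))))
    (hc : ∀ μ y, |c μ y| ≤ (W₀ + ∑ s ∈ Finset.range n, (if (Lc : ℤ) ^ s ∣ y μ + 1 then 2 * a (s + 1) else 0)) *
      (K₀ * Real.exp (-(κ * supNorm (quo M y - x₀))) * Real.exp (-(κ * supNorm (quo M y - z₀))))) :
    (∀ μ, Summable fun y : Site (d + 1) => b μ y * c μ y) ∧
      |∑ μ, ∑' y : Site (d + 1), b μ y * c μ y|
        ≤ ((d : ℝ) + 1) * T * K₀ * (W₀ + 2 * α * Lc * n) * ((M : ℝ) ^ (d + 1) * Zl (d + 1) (κ / (4 * ((d : ℝ) + 1)))) *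
            Real.exp (-(κ / 12) * (supNorm (x₀ - u') + supNorm (z₀ - u'))) := by
  -- the three-envelope block-scale weight and its free block sum
  set g : Site (d + 1) → ℝ := fun q => Real.exp (-(κ * supNorm (q - u'))) * Real.exp (-(κ * supNorm (q - x₀))) *
    Real.exp (-(κ * supNorm (q - z₀))) with hgdef
  obtain ⟨hgs, hgle⟩ := tsum_env3_le (d := d) (L := M) hM1 hκ u' x₀ z₀
  have hg0 : ∀ y : Site (d + 1), 0 ≤ g (quo M y) := fun y => by rw [hgdef]; positivity
  -- §1 per direction, with `K y` = leg envelope × gauge envelope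
  have hdir : ∀ μ, (Summable fun y : Site (d + 1) => b μ y * c μ y) ∧
      ∑' y : Site (d + 1), |b μ y * c μ y| ≤ T * K₀ * (W₀ + 2 * α * Lc * n) * ∑' y : Site (d + 1), g (quo M y) := by
    intro μ
    refine tsum_abs_mul_le_of_faceLetter' hLc hM (g := g) hgs ha μ (b := b μ) (c := c μ)
      (K := fun y => K₀ * Real.exp (-(κ * supNorm (quo M y - x₀))) * Real.exp (-(κ * supNorm (quo M y - z₀))))
      (P := T * K₀) (fun y => by positivity) hW₀ (fun y => ?_) (hc μ)
    have hpos : 0 ≤ K₀ * Real.exp (-(κ * supNorm (quo M y - x₀))) * Real.exp (-(κ * supNorm (quo M y - z₀))) := by positivity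
    calc |b μ y| * (K₀ * Real.exp (-(κ * supNorm (quo M y - x₀))) * Real.exp (-(κ * supNorm (quo M y - z₀))))
        ≤ (T * Real.exp (-(κ * supNorm (quo M y - u')))) *
            (K₀ * Real.exp (-(κ * supNorm (quo M y - x₀))) * Real.exp (-(κ * supNorm (quo M y - z₀)))) :=
          mul_le_mul_of_nonneg_right (hb μ y) hpos
      _ = T * K₀ * g (quo M y) := by rw [hgdef]; ring
  refine ⟨fun μ => (hdir μ).1, ?_⟩
  have hmass : 0 ≤ ∑' y : Site (d + 1), g (quo M y) := tsum_nonneg hg0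
  have hpre : 0 ≤ T * K₀ * (W₀ + 2 * α * Lc * n) := by
    -- `W₀ + 2αLc·n ≥ 0` from the letters (`a 1 ≤ α·Lc` forces `α ≥ 0` when `n ≥ 1`)
    have hαn : 0 ≤ W₀ + 2 * α * Lc * n := by
      rcases Nat.eq_zero_or_pos n with hn | hn
      · subst hn; simpa using hW₀
      · have h0 := ha 0 hn
        have hL1 : (1 : ℝ) ≤ Lc := by exact_mod_cast hLc
        have hα : 0 ≤ α := by
          have h2 : 0 ≤ α * (Lc : ℝ) ^ (0 + 1) := h0.1.trans h0.2
          rw [zero_add, pow_one] at h2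
          exact nonneg_of_mul_nonneg_left h2 (by linarith)
        positivity
    positivity
  calc |∑ μ, ∑' y : Site (d + 1), b μ y * c μ y| ≤ ∑ μ, ∑' y : Site (d + 1), |b μ y * c μ y| := abs_sum_tsum_le fun μ => (hdir μ).1
    _ ≤ ∑ _μ : Fin (d + 1), T * K₀ * (W₀ + 2 * α * Lc * n) * ∑' y : Site (d + 1), g (quo M y) := Finset.sum_le_sum fun μ _ => (hdir μ).2
    _ = ((d : ℝ) + 1) * (T * K₀ * (W₀ + 2 * α * Lc * n) * ∑' y : Site (d + 1), g (quo M y)) := by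
        rw [Finset.sum_const, Finset.card_univ, Fintype.card_fin, nsmul_eq_mul]; push_cast; ring
    _ ≤ ((d : ℝ) + 1) * (T * K₀ * (W₀ + 2 * α * Lc * n) * (((M : ℝ) ^ (d + 1) * Zl (d + 1) (κ / (4 * ((d : ℝ) + 1)))) *
          Real.exp (-(κ / 12) * (supNorm (x₀ - u') + supNorm (z₀ - u'))))) := by
        refine mul_le_mul_of_nonneg_left (mul_le_mul_of_nonneg_left ?_ hpre) (by positivity)
        have h := hgle
        rw [hgdef] at hmass ⊢
        simpa only [mul_assoc] using h
    _ = _ := by ring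

end Summit.QuantumFields.BalabanUV.Beta.GAN24.ContactLambdaCellBound

end
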